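import Summits.ResolutionOfSingularities.ResolutionOfSingularities.Theorems.TightDefectClasses
import HarnessLib

/-!
# TightDefectStrongWalks — the DECIDED piece of the decomp-res node «TightDefect» (lens-3 g9) PROVED in the model:
  `strongWalksTerminate : StrongWalksTerminate` (route-independent; CRITIC-LEDGER row 61 «PROVED LEAF +1»)

Source HOME/decomp-res-lens-3/g9/TightDefect.lean rev 3 (sha256 ce2c464e72c152cd), §§ Isolation / Strong verbatim over
`Theorems.TightDefectClasses`.  An infinite forced walk of the typed point-blow-up model (|σ| = 3, any `q = pᵉ`, any
perfect `K`) from a root state has NO stage of shade 0 (Benito–Villamayor Thm. 7.19 + Prop. 7.18 read on forced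
towers): `u^r ∣ F` and `ord₀ F ≥ q` persist; ISOLATION forces the light boundary `r_i + r_k < q`
(`pair_lt_of_isolatedTop`); from a shade-0 stage the corner coefficient of `u^{r'}` survives transform, translation
and
cleaning (`q ∣ r'` excluded by equimultiplicity), so shade 0 persists while `|r'| < |r|` (`strong_step`,
`no_strictAnti_nat`).  Corollaries: `walksTerminate_iff_defect`, `polyPureTowersTerminateDeep_of_defectDeep`.  The
E-side wiring and the collapse assembly are in `Theorems.MaxContactCutTightDefect`.  No `sorry`, no `set_option`.
References: Benito–Villamayor, Compositio Math. 149 (2013) Thm. 7.19, Prop. 7.18; Hauser2010 §§F–G; Moh1987.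
-/



open Literature.AlgebraicGeometry.Resolution
open Literature.AlgebraicGeometry.Resolution.PointBlowup
open Summit.ResolutionOfSingularities.ResolutionOfSingularities.Theorems.TightDefectClasses

namespace Summit.ResolutionOfSingularities.ResolutionOfSingularities.Theorems.TightDefectStrongWalks


section Isolation

open MvPolynomial

variable {σ : Type} {K : Type} [Field K]

/-- Hasse derivatives of order `< q` of a multiple of `u_i^a u_j^b`, `a + b ≥ q`, lie in `(u_i, u_j)` (Taylor-expand
mod `(x_i, x_j)`; the `u^γ`-coefficient of `u_i^a u_j^b T` vanishes for `|γ| < a + b`). [folklore] -/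
theorem hasseDeriv_mem_span_pair [DecidableEq σ] {F H : MvPolynomial σ K} {i j : σ} {a b q : ℕ}
    (hF : F = X i ^ a * X j ^ b * H) (hab : q ≤ a + b) (γ : σ →₀ ℕ) (hγ : γ.degree < q) :
    hasseDeriv K γ F ∈ Ideal.span ({X i, X j} : Set (MvPolynomial σ K)) := by
  classical
  set P : Ideal (MvPolynomial σ K) := Ideal.span ({X i, X j} : Set (MvPolynomial σ K)) with hP
  set PS : Ideal (MvPolynomial σ (MvPolynomial σ K)) :=
    Ideal.map (C : MvPolynomial σ K →+* MvPolynomial σ (MvPolynomial σ K)) P with hPS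
  have hXi : (C (X i) : MvPolynomial σ (MvPolynomial σ K)) ∈ PS :=
    Ideal.mem_map_of_mem _ (Ideal.subset_span (show (X i : MvPolynomial σ K) ∈ ({X i, X j} : Set _) by simp))
  have hXj : (C (X j) : MvPolynomial σ (MvPolynomial σ K)) ∈ PS :=
    Ideal.mem_map_of_mem _ (Ideal.subset_span (show (X j : MvPolynomial σ K) ∈ ({X i, X j} : Set _) by simp))
  have hT : taylor K F - X i ^ a * X j ^ b * taylor K H ∈ PS := by
    rw [← Ideal.Quotient.eq, hF]
    have hi : Ideal.Quotient.mk PS (C (X i)) = 0 := Ideal.Quotient.eq_zero_iff_mem.mpr hXi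
    have hj : Ideal.Quotient.mk PS (C (X j)) = 0 := Ideal.Quotient.eq_zero_iff_mem.mpr hXj
    simp only [map_mul, map_pow, taylor_X, map_add, hi, hj, zero_add]
  have h2 : coeff γ (X i ^ a * X j ^ b * taylor K H : MvPolynomial σ (MvPolynomial σ K)) = 0 := by
    rw [show (X i ^ a * X j ^ b : MvPolynomial σ (MvPolynomial σ K)) =
        monomial (Finsupp.single i a + Finsupp.single j b) 1 by
          rw [X_pow_eq_monomial, X_pow_eq_monomial, monomial_mul, one_mul],
      coeff_monomial_mul', if_neg]
    intro hle
    have hsd : (Finsupp.single i a + Finsupp.single j b).degree = a + b := by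
      rw [map_add, Finsupp.degree_single, Finsupp.degree_single]
    have hmono : (Finsupp.single i a + Finsupp.single j b).degree ≤ γ.degree := by
      have h := add_tsub_cancel_of_le hle
      calc (Finsupp.single i a + Finsupp.single j b).degree
          ≤ (Finsupp.single i a + Finsupp.single j b).degree +
              (γ - (Finsupp.single i a + Finsupp.single j b)).degree :=
            Nat.le_add_right _ _
        _ = ((Finsupp.single i a + Finsupp.single j b) + (γ - (Finsupp.single i a + Finsupp.single j b))).degree :=
            (map_add Finsupp.degree _ _).symm
        _ = γ.degree := by rw [h]
    omega
  have h1 : coeff γ (taylor K F - X i ^ a * X j ^ b * taylor K H) ∈ P := (mem_map_C_iff.mp hT) γ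
  rw [coeff_sub, h2, sub_zero] at h1
  rwa [hasseDeriv_apply]

/-- Hence the whole top-locus ideal lies in `(u_i, u_j)`. [folklore] -/
theorem topIdeal_le_span_pair [DecidableEq σ] {H : MvPolynomial σ K} {i j : σ} {a b q : ℕ} (hab : q ≤ a + b) :
    topIdeal q (X i ^ a * X j ^ b * H) ≤ Ideal.span ({X i, X j} : Set (MvPolynomial σ K)) := by
  refine Ideal.span_le.mpr ?_
  rintro _ ⟨γ, ⟨_, hγ⟩, rfl⟩
  exact hasseDeriv_mem_span_pair rfl hab γ hγ

/-- **No isolation across a heavy pair**: `u_i^a u_j^b ∣ F`, `a + b ≥ q`, and a third variable `u_k` make the origin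
a NON-isolated top point (kill every variable but `u_k`). [folklore] -/
theorem not_isolatedTop_of_dvd [DecidableEq σ] {F : MvPolynomial σ K} {i j k : σ} (hki : k ≠ i) (hkj : k ≠ j)
    {a b q : ℕ} (hdiv : X i ^ a * X j ^ b ∣ F) (hab : q ≤ a + b) : ¬ IsolatedTop q F := by
  classical
  rintro ⟨N, g, hg0, hg⟩
  obtain ⟨H, rfl⟩ := hdiv
  let ψ : MvPolynomial σ K →ₐ[K] MvPolynomial σ K := aeval fun l => if l = k then X k else 0
  have hψi : ψ (X i) = 0 := by simp [ψ, if_neg (Ne.symm hki)]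
  have hψj : ψ (X j) = 0 := by simp [ψ, if_neg (Ne.symm hkj)]
  have hψk : ψ (X k) = X k := by simp [ψ]
  have hker : Ideal.span ({X i, X j} : Set (MvPolynomial σ K)) ≤ RingHom.ker ψ.toRingHom := by
    refine Ideal.span_le.mpr ?_
    intro y hy
    simp only [Set.mem_insert_iff, Set.mem_singleton_iff] at hy
    rcases hy with rfl | rfl
    · simpa [RingHom.mem_ker] using hψi
    · simpa [RingHom.mem_ker] using hψj
  have h1 : ψ g * X k ^ N = 0 := by
    have := hker (topIdeal_le_span_pair (H := H) hab (hg k))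
    rw [RingHom.mem_ker] at this
    simpa [map_mul, map_pow, hψk] using this
  have h2 : ψ g = 0 := by
    rcases mul_eq_zero.mp h1 with h | h
    · exact h
    · exact absurd h (pow_ne_zero _ (X_ne_zero k))
  have h3 : constantCoeff (ψ g) = constantCoeff g := by
    have hcomp : (constantCoeff : MvPolynomial σ K →+* K).comp ψ.toRingHom = constantCoeff := by
      refine MvPolynomial.ringHom_ext (fun c => ?_) (fun l => ?_)
      · simp [ψ]
      · by_cases h : l = k
        · subst h; simp [hψk]
        · simp [ψ, if_neg h]
    exact RingHom.congr_fun hcomp g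
  exact hg0 (by rw [← h3, h2, map_zero])

/-- **Pairwise bound (|σ| = 3)**: at an ISOLATED top point, `u_i^a u_j^b ∣ F` (`i ≠ j`) forces `a + b < q`.
[folklore] -/
theorem pair_lt_of_isolatedTop {F : MvPolynomial (Fin 3) K} {q : ℕ} (h : IsolatedTop q F) (i j : Fin 3) (hij : i ≠ j)
    {a b : ℕ} (hdiv : X i ^ a * X j ^ b ∣ F) : a + b < q := by
  classical
  have aux : ∀ i j : Fin 3, i ≠ j → ∃ k : Fin 3, k ≠ i ∧ k ≠ j := by decide
  obtain ⟨k, hki, hkj⟩ := aux i j hij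
  by_contra hab
  exact not_isolatedTop_of_dvd hki hkj hdiv (not_lt.mp hab) h

end Isolation

/-- No infinite strictly decreasing sequence in ℕ: the strong-monomial forced walk is finite. [folklore] -/
theorem no_strictAnti_nat (m : ℕ → ℕ) (h : ∀ i, m (i + 1) < m i) : False := by
  have key : ∀ i, m i + i ≤ m 0 := by
    intro i
    induction i with
    | zero => simp
    | succ n ih => have := h n; omega
  have := key (m 0 + 1)
  omega

section Strong

open MvPolynomial Finset
open Literature.AlgebraicGeometry.Resolution.Hauser2010

variable {K : Type} [Field K] [DecidableEq K]

omit [DecidableEq K] in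
/-- An isolated top point has a non-zero residual polynomial (`J_0 = 0`). [folklore] -/
theorem ne_zero_of_isolatedTop {q : ℕ} {F : MvPolynomial (Fin 3) K} (h : IsolatedTop q F) : F ≠ 0 := by
  rintro rfl
  obtain ⟨N, g, hg, hmem⟩ := h
  have hbot : topIdeal q (0 : MvPolynomial (Fin 3) K) = ⊥ := by
    unfold topIdeal
    rw [Ideal.span_eq_bot]
    rintro _ ⟨d, -, rfl⟩
    exact map_zero _
  have h0 := hmem 0
  rw [hbot, Ideal.mem_bot, mul_eq_zero] at h0
  rcases h0 with h0 | h0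
  · exact hg (by rw [h0, map_zero])
  · exact pow_ne_zero N (X_ne_zero (0 : Fin 3)) h0

omit [DecidableEq K] in
/-- `u^r ∣ F` (as the support bound `r ≤ d`) gives `u_i^{r_i} u_k^{r_k} ∣ F` for every pair `i ≠ k`. [folklore] -/
theorem X_pow_mul_X_pow_dvd_of_forall_le {σ : Type} {F : MvPolynomial σ K} {r : σ →₀ ℕ}
    (hr : ∀ d ∈ F.support, r ≤ d) {i k : σ} (hik : i ≠ k) : X i ^ r i * X k ^ r k ∣ F := by
  classical
  rw [F.as_sum]
  refine Finset.dvd_sum fun d hd => ?_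
  have hle : ∀ l, r l ≤ d l := fun l => Finsupp.le_def.mp (hr d hd) l
  have h1 : Finsupp.single i (r i) + Finsupp.single k (r k) ≤ d := by
    refine Finsupp.le_def.mpr fun l => ?_
    rw [Finsupp.add_apply, Finsupp.single_apply, Finsupp.single_apply]
    have := hle l
    by_cases h1 : i = l
    · subst h1
      rw [if_pos rfl, if_neg (Ne.symm hik)]
      omega
    · rw [if_neg h1]
      by_cases h2 : k = l
      · subst h2; rw [if_pos rfl]; omega
      · rw [if_neg h2]; omega
  refine ⟨monomial (d - (Finsupp.single i (r i) + Finsupp.single k (r k))) (coeff d F), ?_⟩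
  rw [X_pow_eq_monomial, X_pow_eq_monomial, monomial_mul, monomial_mul, one_mul, one_mul,
    add_tsub_cancel_of_le h1]

omit [DecidableEq K] in
/-- At a shade-0 state whose exceptional monomial bounds the support, `u^r` IS a monomial of `F` and `ord₀ F = |r|`.
[folklore] -/
theorem coeff_ne_zero_of_shade_zero {σ : Type} [Fintype σ] {F : MvPolynomial σ K} {r : σ →₀ ℕ} {o : ℕ}
    (ho : ordZero F = o) (hr : ∀ d ∈ F.support, r ≤ d) (h0 : o ≤ r.degree) : coeff r F ≠ 0 ∧ o = r.degree := by
  obtain ⟨⟨d, hd, hdeg⟩, -⟩ := (ordZero_eq_nat_iff F o).mp ho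
  have hrd : r ≤ d := hr d (MvPolynomial.mem_support_iff.mpr hd)
  rcases hrd.lt_or_eq with hlt | heq
  · have := PointBlowup.degree_lt_degree_of_lt hlt
    omega
  · subst heq
    exact ⟨hd, hdeg.symm⟩

/-- In three indices, the sum of the two multiplicities other than `r_j` is `< q` when all pairwise sums are `< q`
(so `|r| < q + r_j < 2q`). [folklore] -/
theorem sum_erase_lt_of_pairwise {q : ℕ} (r : Fin 3 → ℕ) (hpair : ∀ i k : Fin 3, i ≠ k → r i + r k < q) (j : Fin 3) :
    ∑ i ∈ univ.erase j, r i < q := by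
  have hcard : (univ.erase j).card = 2 := by
    rw [Finset.card_erase_of_mem (Finset.mem_univ j), Finset.card_univ, Fintype.card_fin]
  obtain ⟨x, y, hxy, hxy'⟩ := Finset.card_eq_two.mp hcard
  rw [hxy', Finset.sum_pair hxy]
  exact hpair x y hxy

/-- **One forced step from a shade-0 stage**: the total exceptional multiplicity DROPS and the corner monomial
`u^{r'}` survives chart transform, translation and cleaning, so the shade stays `0`. [folklore]
(Benito–Villamayor 2013 Prop. 7.18, Thm. 7.19; Hauser 2010 §F.) -/
theorem strong_step {q : ℕ} (s : State (Fin 3) K) (j : Fin 3) (b : Fin 3 → K) (hbj : b j = 0)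
    (heq : IsEquimultiplePoint q j b s) {o : ℕ} (ho : ordZero s.F = o) (hqo : q ≤ o)
    (hr : ∀ d ∈ s.F.support, s.r ≤ d) (hpair : ∀ i k : Fin 3, i ≠ k → s.r i + s.r k < q) (h0 : o ≤ s.r.degree) :
    (step q j b s).r.degree < s.r.degree ∧ ordZero (step q j b s).F ≤ (((step q j b s).r.degree : ℕ) : ℕ∞) := by
  classical
  obtain ⟨hcr, hodeg⟩ := coeff_ne_zero_of_shade_zero ho hr h0
  have aux3 : ∀ i : Fin 3, ∃ k : Fin 3, k ≠ i := by decide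
  have hrlt : ∀ i, s.r i < q := fun i => by
    obtain ⟨k, hk⟩ := aux3 i
    have := hpair i k hk.symm
    omega
  have hsumr : s.r j + ∑ i ∈ univ.erase j, s.r i = o := by
    rw [hodeg, Finsupp.degree_eq_sum]
    exact Finset.add_sum_erase _ _ (Finset.mem_univ j)
  have herase := sum_erase_lt_of_pairwise (⇑s.r) hpair j
  have hr' : ∀ i, (step q j b s).r i = if b i = 0 then (if i = j then o - q else s.r i) else 0 := by
    intro i
    change newMult q j b s i = _
    rw [PointBlowup.newMult_eq q j b hbj s ho, Finsupp.filter_apply, Finsupp.update_apply]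
  have hr'j : (step q j b s).r j = o - q := by rw [hr' j, if_pos hbj, if_pos rfl]
  have hr'i : ∀ i, i ≠ j → (step q j b s).r i ≤ s.r i := fun i hi => by
    rw [hr' i, if_neg hi]; split_ifs <;> omega
  have ha : (step q j b s).r.degree < s.r.degree := by
    rw [Finsupp.degree_eq_sum ((step q j b s).r), ← Finset.add_sum_erase _ _ (Finset.mem_univ j), hr'j, ← hodeg]
    have : ∑ i ∈ univ.erase j, (step q j b s).r i ≤ ∑ i ∈ univ.erase j, s.r i :=
      Finset.sum_le_sum fun i hi => hr'i i (Finset.ne_of_mem_erase hi)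
    omega
  refine ⟨ha, ?_⟩
  have hcE : ∀ i, chartExponent q j s.r i = if i = j then o - q else s.r i := fun i => by
    rw [PointBlowup.chartExponent_apply, ← hodeg]
  have hother : ∀ d ∈ s.F.support, d ≠ s.r → ∀ D : Fin 3 →₀ ℕ, D j ≤ o - q →
      coeff D (translate b (monomial (chartExponent q j d) (coeff d s.F))) = 0 := by
    intro d hd hne D hDj
    have hlt : s.r < d := lt_of_le_of_ne (hr d hd) (Ne.symm hne)
    have hdeg := PointBlowup.degree_lt_degree_of_lt hlt
    refine WeightedBlowup.coeff_translate_monomial_eq_zero_of_apply_eq_zero b _ D _ hbj ?_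
    rw [PointBlowup.chartExponent_apply, if_pos rfl]
    omega
  have hnotP : ¬ IsPthPowerExponent q (step q j b s).r := by
    intro hP
    rw [isPthPowerExponent_iff] at hP
    have hoq : o = q := by
      have h1 := hP j
      rw [hr'j] at h1
      have h2 : o - q < q := by have := hrlt j; omega
      have h3 := Nat.eq_zero_of_dvd_of_lt h1 h2
      omega
    have hzero : ∀ i, i ≠ j → b i = 0 → s.r i = 0 := fun i hi hbi => by
      have h1 := hP i
      rw [hr' i, if_pos hbi, if_neg hi] at h1
      exact Nat.eq_zero_of_dvd_of_lt h1 (hrlt i)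
    have hex : ∃ i ∈ univ.erase j, s.r i ≠ 0 := by
      apply Finset.exists_ne_zero_of_sum_ne_zero
      have := hrlt j
      omega
    obtain ⟨i, hi, hri⟩ := hex
    have hij : i ≠ j := Finset.ne_of_mem_erase hi
    have hbi : b i ≠ 0 := fun h => hri (hzero i hij h)
    set D₀ : Fin 3 →₀ ℕ := Finsupp.single i (s.r i) with hD₀
    have hD₀ne : D₀ ≠ 0 := Finsupp.single_ne_zero.mpr hri
    have hD₀deg : D₀.degree < q := by rw [hD₀, Finsupp.degree_single]; exact hrlt i
    have hzeroq := heq D₀ hD₀ne hD₀deg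
    revert hzeroq
    show coeff D₀ (pointTransform q j b s) = 0 → False
    rw [imp_false, ← Ne, PointBlowup.pointTransform_eq_sum, coeff_sum,
      Finset.sum_eq_single_of_mem s.r (MvPolynomial.mem_support_iff.mpr hcr) (fun d hd hne =>
        hother d hd hne D₀ (by rw [hD₀, Finsupp.single_apply, if_neg hij]; exact Nat.zero_le _)),
      WeightedBlowup.coeff_translate_monomial]
    refine mul_ne_zero hcr (Finset.prod_ne_zero_iff.mpr fun i' _ => ?_)
    rw [hcE i', hD₀, Finsupp.single_apply]
    by_cases h1 : i = i'
    · subst h1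
      rw [if_pos rfl, if_neg hij, Nat.choose_self, Nat.sub_self, pow_zero, mul_one, Nat.cast_one]
      exact one_ne_zero
    · rw [if_neg h1, Nat.choose_zero_right, Nat.cast_one, one_mul, Nat.sub_zero]
      by_cases h2 : i' = j
      · rw [if_pos h2, hoq, Nat.sub_self, pow_zero]; exact one_ne_zero
      · rw [if_neg h2]
        by_cases h3 : s.r i' = 0
        · rw [h3, pow_zero]; exact one_ne_zero
        · exact pow_ne_zero _ fun h => h3 (hzero i' h2 h)
  have hcorner : coeff (step q j b s).r (step q j b s).F ≠ 0 := by
    change coeff (step q j b s).r (deletePthPowers q (pointTransform q j b s)) ≠ 0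
    rw [coeff_deletePthPowers, if_neg hnotP, PointBlowup.pointTransform_eq_sum, coeff_sum,
      Finset.sum_eq_single_of_mem s.r (MvPolynomial.mem_support_iff.mpr hcr) (fun d hd hne =>
        hother d hd hne _ (by rw [hr'j])),
      WeightedBlowup.coeff_translate_monomial]
    refine mul_ne_zero hcr (Finset.prod_ne_zero_iff.mpr fun i' _ => ?_)
    rw [hcE i', hr' i']
    by_cases hb : b i' = 0
    · rw [if_pos hb, Nat.choose_self, Nat.sub_self, pow_zero, mul_one, Nat.cast_one]
      exact one_ne_zero
    · rw [if_neg hb, Nat.choose_zero_right, Nat.cast_one, one_mul, Nat.sub_zero]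
      exact pow_ne_zero _ hb
  exact Literature.Barriers.ResolutionOfSingularities.ordZero_le_of_coeff_ne_zero _ _ hcorner

/-- **`StrongWalksTerminate` PROVED**: an infinite forced walk from a root never reaches shade 0 — from such a stage
on, shade 0 persists and the total exceptional multiplicity strictly decreases forever.
(Benito–Villamayor 2013 Thm. 7.19, Prop. 7.18; Hauser 2010 §§F–G.) [folklore] -/
theorem strongWalksTerminate : StrongWalksTerminate := by
  intro p hp e he K _ _ _ _ s₀ hroot W hex
  classical
  obtain ⟨i₀, hi₀⟩ := hex
  have hord : ∀ n, (((p ^ e : ℕ) : ℕ) : ℕ∞) ≤ ordZero (W.st n).F := by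
    intro n
    induction n with
    | zero => rw [W.st_zero]; exact hroot.2.2
    | succ n ih =>
      rw [W.st_succ]
      exact PointBlowup.le_ordZero_step_of_isEquimultiplePoint _ _ _ _ (W.equimult n)
  have hnat : ∀ n, ∃ o : ℕ, ordZero (W.st n).F = o ∧ p ^ e ≤ o := fun n => by
    obtain ⟨o, ho⟩ := exists_ordZero_eq_natCast (ne_zero_of_isolatedTop (W.isolated n))
    refine ⟨o, ho, ?_⟩
    have := hord n
    rw [ho] at this
    exact_mod_cast this
  have hr : ∀ n, ∀ d ∈ (W.st n).F.support, (W.st n).r ≤ d := by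
    intro n
    induction n with
    | zero =>
      intro d _
      rw [W.st_zero, hroot.1]
      exact Finsupp.le_def.mpr fun i => by simp
    | succ n ih =>
      obtain ⟨o, ho, -⟩ := hnat n
      rw [W.st_succ]
      exact PointBlowup.newMult_le_of_mem_support_step _ _ _ (W.onExc n) _ ho ih
  have hpair : ∀ n (i k : Fin 3), i ≠ k → (W.st n).r i + (W.st n).r k < p ^ e := fun n i k hik =>
    pair_lt_of_isolatedTop (W.isolated n) i k hik (X_pow_mul_X_pow_dvd_of_forall_le (hr n) hik)
  have hshade_iff : ∀ n (o : ℕ), ordZero (W.st n).F = o → ((W.st n).shade = 0 ↔ o ≤ (W.st n).r.degree) := by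
    intro n o ho
    rw [PointBlowup.shade_eq_of_ordZero_eq _ ho, Nat.cast_eq_zero, Nat.sub_eq_zero_iff_le]
  have key : ∀ m, (W.st (i₀ + m)).shade = 0 ∧ (W.st (i₀ + m + 1)).r.degree < (W.st (i₀ + m)).r.degree := by
    intro m
    induction m with
    | zero =>
      obtain ⟨o, ho, hqo⟩ := hnat i₀
      have h0 := (hshade_iff i₀ o ho).mp hi₀
      obtain ⟨ha, hb⟩ := strong_step (W.st i₀) (W.j i₀) (W.b i₀) (W.onExc i₀) (W.equimult i₀) ho hqo (hr i₀)
        (hpair i₀) h0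
      refine ⟨hi₀, ?_⟩
      rw [Nat.add_zero, W.st_succ]
      exact ha
    | succ m ih =>
      show (W.st (i₀ + m + 1)).shade = 0 ∧ (W.st (i₀ + m + 1 + 1)).r.degree < (W.st (i₀ + m + 1)).r.degree
      obtain ⟨o, ho, hqo⟩ := hnat (i₀ + m)
      have h0 := (hshade_iff (i₀ + m) o ho).mp ih.1
      obtain ⟨-, hb⟩ := strong_step (W.st (i₀ + m)) (W.j (i₀ + m)) (W.b (i₀ + m)) (W.onExc (i₀ + m))
        (W.equimult (i₀ + m)) ho hqo (hr (i₀ + m)) (hpair (i₀ + m)) h0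
      rw [← W.st_succ] at hb
      have hsh : (W.st (i₀ + m + 1)).shade = 0 := by
        unfold State.shade
        exact tsub_eq_zero_of_le hb
      obtain ⟨o', ho', hqo'⟩ := hnat (i₀ + m + 1)
      have h0' := (hshade_iff (i₀ + m + 1) o' ho').mp hsh
      obtain ⟨ha', -⟩ := strong_step (W.st (i₀ + m + 1)) (W.j (i₀ + m + 1)) (W.b (i₀ + m + 1))
        (W.onExc (i₀ + m + 1)) (W.equimult (i₀ + m + 1)) ho' hqo' (hr (i₀ + m + 1)) (hpair (i₀ + m + 1)) h0'
      refine ⟨hsh, ?_⟩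
      rw [W.st_succ (i₀ + m + 1)]
      exact ha'
  exact no_strictAnti_nat (fun m => (W.st (i₀ + m)).r.degree) fun m => (key m).2

/-- Hence the cut is `WalksTerminate ⟺ DefectWalksTerminate`: the located residual IS the slice image. [folklore] -/
theorem walksTerminate_iff_defect : WalksTerminate ↔ DefectWalksTerminate :=
  ⟨defect_of_walks, fun hD => walks_of_pieces strongWalksTerminate hD⟩

/-- **The deep column of the slice hangs on the deep model residual alone** (dictionary at `e ≥ 2` + the PROVED
`strongWalksTerminate` for the shade-0 walks). [folklore] -/
theorem polyPureTowersTerminateDeep_of_defectDeep (hT : TowerDictionary) (hΔ : DefectWalksTerminateDeep) :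
    PolyPureTowersTerminateDeep := by
  intro p hp e he k _ _ _ F T g hg hD hB hR
  refine hT p hp e (one_le_two.trans he) k F T g hg hD hB hR ?_
  intro K _ _ _ _ s₀ hs W
  by_cases h0 : ∃ i, (W.st i).shade = 0
  · exact strongWalksTerminate p hp e (one_le_two.trans he) K s₀ hs W h0
  · exact hΔ p hp e he K s₀ hs W (fun i => Order.one_le_iff_ne_zero.mpr (fun h => h0 ⟨i, h⟩))

end Strong

end Summit.ResolutionOfSingularities.ResolutionOfSingularities.Theorems.TightDefectStrongWalks
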